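import Literature.Probability.RandomPlanarGeometry.HexSAWStripSurfaceWidthTwo
import Literature.Probability.RandomPlanarGeometry.HexSAWStripSurfaceLimits
import HarnessLib

/-!
# At its own threshold the width-two strip diverges LINEARLY: `c·(L − 1) ≤ B_{2,L}(x_c; y_2) ≤ C·(L + 3)` with explicit `c, C`

Topic `Literature/Probability/RandomPlanarGeometry` (continues `HexSAWStripSurfaceWidthTwo.lean` — the solved width-two strip with a
surface fugacity: the weave transfer matrix `M(y) = [[x², x³y],[x³, x²y]]`, the sums `W2.wsumY`, `W2.rsumY`, the family sum `W2.fsumY`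
with its closed form `W2.fsumY_eq`, the comparisons `W2.fsumY_le_stripGFy : fsumY(N) ≤ B_{2,2N}` / `W2.stripGFy_le_fsumY :
B_{2,L} ≤ fsumY(L+2)`, the threshold `W2.yTwo = y_2 = (10 + 8√2)/7` with `HV.stripYT_two`, the Perron vector bound
`W2.wsumY_succ_ge` and the linear LOWER bound `W2.fsumY_yTwo_ge : 2x_c⁴y_2·N ≤ fsumY(N)` at `y = y_2` — and
`HexSAWStripSurfaceLimits.lean`: `HV.stripGFy_beta_mono_L`).  Source frame: N. R. Beaton, M. Bousquet-Mélou, J. de Gier, H. Duminil-Copin,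
A. J. Guttmann, *The critical fugacity for surface adsorption of self-avoiding walks on the honeycomb lattice is `1 + √2`*, Comm. Math.
Phys. 326 (2014) 727–754, arXiv:1109.0358v5, §3.2 Corollary 8 (p. 12: "The series (in `y`) `A_T(x_c,y)`, `B_T(x_c,y)` and `C_T(x_c,y)` have
radius of convergence `y_T`"; the strip series are rational, p. 12: "is a rational function of x and y", and diverge at their radius, proof of
Proposition 7, p. 11); companion of the width-one file `HexSAWStripSurfaceWidthOneThreshold.lean` (`B_{1,L}(x_c; y_1) = 2(L+1)`, exactly linear).

## What is proved (namespace `Literature.Probability.RandomPlanarGeometry.SAW.HV`, helper namespace `…HV.W2`; standard axioms)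

At the critical parameter `y = y(x) := (1 − x²)/(x²(1 − x² + x⁴))` of the weave matrix (`det(I − M(y)) = 0`) the vector
`u = (x³y, 1 − x²)` is a Perron eigenvector, `M(y)u = u`; so every weave sum whose end weight is dominated by `K·u` stays dominated
(`W2.wsumY_le_perron`), and the partial sums grow at most linearly (`W2.sum_wsumY_le_perron`).  At `x = x_c` (`y(x_c) = y_2`) this gives

* `W2.fsumY_yTwo_le : fsumY x_c y_2 N ≤ 2x_c·E₂·(1 + K₂(1 − x_c²)·N) + 2x_c⁴y_2·K₂·N` with the excursion series bound
  `E₂ = x_c³y_2/(1 − x_c⁴y_2)` and `K₂ = 1/(1 − x_c²) = √2` — an explicit `A₂ + B₂·N` with `A₂ = 2x_c E₂ = √2/2 = 0.7071…` and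
  `B₂ = 2√2·x_c⁴y_2 + 2x_c E₂ = 1.4459…` (the true slope of `B_{2,L}(x_c; y_2)` per unit `L` is `1.4377…` by exact enumeration);
* ★ **`stripGFy_two_stripYT_two_le : B_{2,L}(x_c; y_2) ≤ W2.linA + W2.linB·(L + 2)`** and
  ★ **`stripGFy_two_stripYT_two_ge : x_c⁴ y_2 · (L − 1) ≤ B_{2,L}(x_c; y_2)`** (every `L`; the lower bound is the tree's at even
  lengths, moved to all `L` by monotonicity in `L`);
* `stripGFy_two_stripYT_two_div_le` / `…_div_ge` — for `L ≥ 1`: `x_c⁴y_2 (L−1)/L ≤ B_{2,L}(x_c;y_2)/L ≤ W2.linA + 3·W2.linB`, i.e.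
  `B_{2,L}(x_c; y_2) ≍ L`: the width-two strip, like the width-one strip, diverges EXACTLY LINEARLY at its own threshold (the general
  strip is only known to diverge at least like `√L` there — lane file «THRESHOLD-DIVERGENCE-RATE»).

Label: lane corollary, XS (explicit two-sided instance; not stated in print).  Lane «pcv-sawmu», a-p2 g12, 2026-08-24 (edition 2: the
domination constant sharpened from `1/(1 − x_c²) + 1/(1 − x_c⁴y_2)` to `1/(1 − x_c²)`, so the upper slope `B₂` drops from `2.83` to `1.4459`).
-/

noncomputable section

open Finset Filter Topology

namespace Literature.Probability.RandomPlanarGeometry.SAW.HV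

namespace W2

/-! ### §1. The Perron vector dominates: weave sums at the critical parameter grow at most linearly -/

/-- **Perron domination at the critical parameter**: with `y = (1 − x²)/(x²(1 − x² + x⁴))` and `u = (x³y, 1 − x²)` (`M(y)u = u`), an
end weight `g ≤ K·u` (componentwise) gives `W_n(g) ≤ K·u` for every `n`.
[cite: BeatonBousquetMelouDeGierDuminilCopinGuttmann2014, Corollary 8 (arXiv v5 p. 12: y_T as the radius of B_T(x_c;y)); lane: width-two transfer bound at the threshold] -/
theorem wsumY_le_perron {x : ℝ} (hx0 : 0 < x) (hx1 : x < 1) {g : Bool → ℝ} {K : ℝ}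
    (hgb : g false ≤ K * (x ^ 3 * ((1 - x ^ 2) / (x ^ 2 * (1 - x ^ 2 + x ^ 4)))))
    (hgt : g true ≤ K * (1 - x ^ 2)) (n : ℕ) :
    wsumY x ((1 - x ^ 2) / (x ^ 2 * (1 - x ^ 2 + x ^ 4))) g n false ≤
        K * (x ^ 3 * ((1 - x ^ 2) / (x ^ 2 * (1 - x ^ 2 + x ^ 4)))) ∧
      wsumY x ((1 - x ^ 2) / (x ^ 2 * (1 - x ^ 2 + x ^ 4))) g n true ≤ K * (1 - x ^ 2) := by
  set y := (1 - x ^ 2) / (x ^ 2 * (1 - x ^ 2 + x ^ 4)) with hy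
  have hq : 0 < 1 - x ^ 2 + x ^ 4 := by nlinarith [sq_nonneg (x ^ 2)]
  have hx2 : 0 < x ^ 2 := by positivity
  have hden : 0 < x ^ 2 * (1 - x ^ 2 + x ^ 4) := mul_pos hx2 hq
  have hy0 : 0 ≤ y := div_nonneg (by nlinarith) hden.le
  -- the eigen-relation `y · x²(1 − x² + x⁴) = 1 − x²`
  have hkey : y * (x ^ 2 * (1 - x ^ 2 + x ^ 4)) = 1 - x ^ 2 := div_mul_cancel₀ _ hden.ne'
  induction n with
  | zero =>
    rw [wsumY_zero, wsumY_zero]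
    exact ⟨hgb, hgt⟩
  | succ n ih =>
    obtain ⟨ihb, iht⟩ := ih
    rw [wsumY_succ x y _ n false, wsumY_succ x y _ n true]
    simp only [if_true, Bool.true_eq_false, if_false]
    have hx3y : 0 ≤ x ^ 3 * y := mul_nonneg (pow_nonneg hx0.le 3) hy0
    have hx2y : 0 ≤ x ^ 2 * y := mul_nonneg (pow_nonneg hx0.le 2) hy0
    constructor
    · calc x ^ 2 * wsumY x y g n false + x ^ 3 * y * wsumY x y g n true
          ≤ x ^ 2 * (K * (x ^ 3 * y)) + x ^ 3 * y * (K * (1 - x ^ 2)) :=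
            add_le_add (mul_le_mul_of_nonneg_left ihb (pow_nonneg hx0.le 2)) (mul_le_mul_of_nonneg_left iht hx3y)
        _ = K * (x ^ 3 * y) := by ring
    · calc x ^ 3 * wsumY x y g n false + x ^ 2 * y * wsumY x y g n true
          ≤ x ^ 3 * (K * (x ^ 3 * y)) + x ^ 2 * y * (K * (1 - x ^ 2)) :=
            add_le_add (mul_le_mul_of_nonneg_left ihb (pow_nonneg hx0.le 3)) (mul_le_mul_of_nonneg_left iht hx2y)
        _ = K * (y * (x ^ 6 + x ^ 2 - x ^ 4)) := by ring
        _ = K * (1 - x ^ 2) := by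
            congr 1
            have : y * (x ^ 6 + x ^ 2 - x ^ 4) = y * (x ^ 2 * (1 - x ^ 2 + x ^ 4)) := by ring
            rw [this, hkey]

/-- **Partial sums of the dominated weave sums grow at most linearly**: `Σ_{n<N} W_{n+1}(g) ≤ N·K·u` componentwise.
[cite: BeatonBousquetMelouDeGierDuminilCopinGuttmann2014, Corollary 8 (arXiv v5 p. 12); lane: width-two transfer bound at the threshold] -/
theorem sum_wsumY_le_perron {x : ℝ} (hx0 : 0 < x) (hx1 : x < 1) {g : Bool → ℝ} {K : ℝ}
    (hgb : g false ≤ K * (x ^ 3 * ((1 - x ^ 2) / (x ^ 2 * (1 - x ^ 2 + x ^ 4)))))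
    (hgt : g true ≤ K * (1 - x ^ 2)) (N : ℕ) :
    (∑ n ∈ Finset.range N, wsumY x ((1 - x ^ 2) / (x ^ 2 * (1 - x ^ 2 + x ^ 4))) g (n + 1) false) ≤
        N * (K * (x ^ 3 * ((1 - x ^ 2) / (x ^ 2 * (1 - x ^ 2 + x ^ 4))))) ∧
      (∑ n ∈ Finset.range N, wsumY x ((1 - x ^ 2) / (x ^ 2 * (1 - x ^ 2 + x ^ 4))) g (n + 1) true) ≤ N * (K * (1 - x ^ 2)) := by
  constructor
  · calc (∑ n ∈ Finset.range N, wsumY x _ g (n + 1) false)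
        ≤ ∑ _n ∈ Finset.range N, K * (x ^ 3 * ((1 - x ^ 2) / (x ^ 2 * (1 - x ^ 2 + x ^ 4)))) :=
          Finset.sum_le_sum fun n _ => (wsumY_le_perron hx0 hx1 hgb hgt (n + 1)).1
      _ = _ := by rw [Finset.sum_const, Finset.card_range, nsmul_eq_mul]
  · calc (∑ n ∈ Finset.range N, wsumY x _ g (n + 1) true)
        ≤ ∑ _n ∈ Finset.range N, K * (1 - x ^ 2) :=
          Finset.sum_le_sum fun n _ => (wsumY_le_perron hx0 hx1 hgb hgt (n + 1)).2
      _ = _ := by rw [Finset.sum_const, Finset.card_range, nsmul_eq_mul]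

/-! ### §2. At `x = x_c`: the explicit linear upper bound for the family sum -/

/-- `x_c⁴ y_2 < 1` (indeed `x_c² y_2 ≤ 1` and `x_c² < 1`): the excursion series converges at the threshold.
[cite: BeatonBousquetMelouDeGierDuminilCopinGuttmann2014, Corollary 8 (arXiv v5 p. 12); lane: width-two bookkeeping] -/
theorem xc_four_mul_yTwo_lt_one : hexCriticalFugacity ^ 4 * yTwo < 1 := by
  have hx := hexCriticalFugacity_pos_lt_one
  have h1 : hexCriticalFugacity ^ 2 * yTwo ≤ 1 := xc_sq_mul_le_one le_rfl
  have : hexCriticalFugacity ^ 4 * yTwo = hexCriticalFugacity ^ 2 * (hexCriticalFugacity ^ 2 * yTwo) := by ring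
  rw [this]
  calc hexCriticalFugacity ^ 2 * (hexCriticalFugacity ^ 2 * yTwo) ≤ hexCriticalFugacity ^ 2 * 1 :=
      mul_le_mul_of_nonneg_left h1 (pow_nonneg hx.1.le 2)
    _ < 1 := by nlinarith [hx.1, hx.2]

/-- `0 < y_2`. [cite: BeatonBousquetMelouDeGierDuminilCopinGuttmann2014, Corollary 8 (arXiv v5 p. 12: y_T > 0); lane: width two] -/
theorem yTwo_pos : 0 < yTwo := by
  have hx := hexCriticalFugacity_pos_lt_one
  exact div_pos (by nlinarith [hx.1, hx.2]) yTwo_den_pos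

/-- The excursion-series bound at the threshold, `E₂ := x_c³ y_2/(1 − x_c⁴ y_2)`.
[cite: BeatonBousquetMelouDeGierDuminilCopinGuttmann2014, §2, eq. (10) (arXiv v5 p. 6: B_{T,L}(x;y)); lane: width-two bookkeeping] -/
def linE : ℝ := hexCriticalFugacity ^ 3 * yTwo / (1 - hexCriticalFugacity ^ 4 * yTwo)

/-- The domination constant at the threshold, `K₂ := 1/(1 − x_c²) = √2` (so that the end weight `(rsumY, 1) ≤ K₂·u`: the top
component with equality, the bottom one because `rsumY ≤ x_c³y_2/(1 − x_c⁴y_2) ≤ x_c³y_2/(1 − x_c²)`, as `x_c⁴ y_2 ≤ x_c²`).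
[cite: BeatonBousquetMelouDeGierDuminilCopinGuttmann2014, Corollary 8 (arXiv v5 p. 12); lane: width-two bookkeeping] -/
def linK : ℝ := 1 / (1 - hexCriticalFugacity ^ 2)

/-- `x_c⁴ y_2 ≤ x_c²` (from `x_c² y_2 ≤ 1`). [cite: BeatonBousquetMelouDeGierDuminilCopinGuttmann2014, Corollary 8 (arXiv v5 p. 12); lane: width-two bookkeeping] -/
theorem xc_four_mul_yTwo_le_xc_sq : hexCriticalFugacity ^ 4 * yTwo ≤ hexCriticalFugacity ^ 2 := by
  have hx := hexCriticalFugacity_pos_lt_one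
  have h1 : hexCriticalFugacity ^ 2 * yTwo ≤ 1 := xc_sq_mul_le_one le_rfl
  have : hexCriticalFugacity ^ 4 * yTwo = hexCriticalFugacity ^ 2 * (hexCriticalFugacity ^ 2 * yTwo) := by ring
  rw [this]
  calc hexCriticalFugacity ^ 2 * (hexCriticalFugacity ^ 2 * yTwo) ≤ hexCriticalFugacity ^ 2 * 1 :=
      mul_le_mul_of_nonneg_left h1 (pow_nonneg hx.1.le 2)
    _ = hexCriticalFugacity ^ 2 := mul_one _

/-- `0 ≤ E₂`. [cite: BeatonBousquetMelouDeGierDuminilCopinGuttmann2014, §2, eq. (10) (arXiv v5 p. 6); lane: width-two bookkeeping] -/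
theorem linE_nonneg : 0 ≤ linE := by
  have hx := hexCriticalFugacity_pos_lt_one
  exact div_nonneg (mul_nonneg (pow_nonneg hx.1.le 3) yTwo_pos.le) (by linarith [xc_four_mul_yTwo_lt_one])

/-- `0 ≤ K₂`. [cite: BeatonBousquetMelouDeGierDuminilCopinGuttmann2014, Corollary 8 (arXiv v5 p. 12); lane: width-two bookkeeping] -/
theorem linK_nonneg : 0 ≤ linK := by
  have hx := hexCriticalFugacity_pos_lt_one
  have h1 : 0 < 1 - hexCriticalFugacity ^ 2 := by nlinarith [hx.1, hx.2]
  unfold linK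
  positivity

/-- **At `y_2` the family sums grow at most linearly**: `fsumY x_c y_2 N ≤ 2x_c·E₂ + (2x_c·K₂·(x_c³y_2 + E₂(1 − x_c²)))·N`
(numerically `0.7071 + 1.4459·N`; the referee's enumerator measures the true slope of `B_{2,L}(x_c; y_2)` as `1.4377` per unit `L`).
[cite: BeatonBousquetMelouDeGierDuminilCopinGuttmann2014, Corollary 8 (arXiv v5 p. 12: y_T as the radius of B_T(x_c;y)); lane: width-two transfer bound at the threshold] -/
theorem fsumY_yTwo_le (N : ℕ) :
    fsumY hexCriticalFugacity yTwo N ≤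
      2 * (hexCriticalFugacity * linE) +
        (2 * (hexCriticalFugacity * linK * (hexCriticalFugacity ^ 3 * yTwo + linE * (1 - hexCriticalFugacity ^ 2)))) * N := by
  set x := hexCriticalFugacity with hxdef
  have hx := hexCriticalFugacity_pos_lt_one
  have hx0 : 0 ≤ x := hx.1.le
  have hy0 : 0 ≤ yTwo := yTwo_pos.le
  have h4 : x ^ 4 * yTwo < 1 := xc_four_mul_yTwo_lt_one
  have h1x2 : 0 < 1 - x ^ 2 := by nlinarith [hx.1, hx.2]
  have h1x4 : 0 < 1 - x ^ 4 * yTwo := by linarith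
  have hrs : rsumY x yTwo N ≤ linE := rsumY_le hx0 hy0 h4 N
  have hrs0 : 0 ≤ rsumY x yTwo N := rsumY_nonneg hx0 hy0 N
  have hE0 : 0 ≤ linE := linE_nonneg
  have hK0 : 0 ≤ linK := linK_nonneg
  set G : Bool → ℝ := fun c => if c then 1 else rsumY x yTwo N with hG
  have hG0 : ∀ r, 0 ≤ G r := fun r => by cases r <;> simp [hG, hrs0]
  -- `y_2` IS the critical parameter of the weave matrix at `x = x_c`
  have hyc : yTwo = (1 - x ^ 2) / (x ^ 2 * (1 - x ^ 2 + x ^ 4)) := rfl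
  -- domination of the end weight by `K₂ · u`
  have hx3y : 0 < x ^ 3 * yTwo := mul_pos (pow_pos hx.1 3) yTwo_pos
  have hKb : G false ≤ linK * (x ^ 3 * yTwo) := by
    have hGf : G false = rsumY x yTwo N := by simp [hG]
    rw [hGf]
    have h4le : x ^ 4 * yTwo ≤ x ^ 2 := xc_four_mul_yTwo_le_xc_sq
    calc rsumY x yTwo N ≤ linE := hrs
      _ = 1 / (1 - x ^ 4 * yTwo) * (x ^ 3 * yTwo) := by rw [linE, hxdef]; field_simp
      _ ≤ linK * (x ^ 3 * yTwo) := by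
          refine mul_le_mul_of_nonneg_right ?_ hx3y.le
          rw [linK, hxdef]
          exact one_div_le_one_div_of_le h1x2 (by linarith)
  have hKt : G true ≤ linK * (1 - x ^ 2) := by
    have hGt : G true = 1 := by simp [hG]
    rw [hGt]
    calc (1 : ℝ) = 1 / (1 - x ^ 2) * (1 - x ^ 2) := by field_simp
      _ ≤ linK * (1 - x ^ 2) := by rw [linK, hxdef]
  have hsum := sum_wsumY_le_perron hx.1 hx.2 (K := linK) (by rw [← hyc]; exact hKb) hKt N
  rw [← hyc] at hsum
  obtain ⟨hsb, hst⟩ := hsum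
  have hT0 : 0 ≤ ∑ n ∈ Finset.range N, wsumY x yTwo G (n + 1) true :=
    Finset.sum_nonneg fun n _ => wsumY_nonneg hx0 hy0 hG0 _ _
  rw [fsumY_eq]
  have hN : 0 ≤ (N : ℝ) := N.cast_nonneg
  -- assemble: 2x[ΣW(⊥) + rsumY ΣW(⊤)] + 2x rsumY ≤ 2x[N K x³y + E N K (1−x²)] + 2x E
  have h1 : rsumY x yTwo N * ∑ n ∈ Finset.range N, wsumY x yTwo G (n + 1) true ≤ linE * (N * (linK * (1 - x ^ 2))) :=
    mul_le_mul hrs hst hT0 hE0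
  have h2 : x * ((∑ n ∈ Finset.range N, wsumY x yTwo G (n + 1) false) +
      rsumY x yTwo N * ∑ n ∈ Finset.range N, wsumY x yTwo G (n + 1) true) ≤
      x * (N * (linK * (x ^ 3 * yTwo)) + linE * (N * (linK * (1 - x ^ 2)))) :=
    mul_le_mul_of_nonneg_left (add_le_add hsb h1) hx0
  have h3 : x * rsumY x yTwo N ≤ x * linE := mul_le_mul_of_nonneg_left hrs hx0
  calc 2 * (x * ((∑ n ∈ Finset.range N, wsumY x yTwo G (n + 1) false) +
        rsumY x yTwo N * ∑ n ∈ Finset.range N, wsumY x yTwo G (n + 1) true)) + 2 * (x * rsumY x yTwo N)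
      ≤ 2 * (x * (N * (linK * (x ^ 3 * yTwo)) + linE * (N * (linK * (1 - x ^ 2))))) + 2 * (x * linE) := by linarith
    _ = 2 * (x * linE) + (2 * (x * linK * (x ^ 3 * yTwo + linE * (1 - x ^ 2)))) * N := by ring

/-- The constant term `A₂ := 2x_c·E₂` of the linear upper bound. [cite: BeatonBousquetMelouDeGierDuminilCopinGuttmann2014, Corollary 8 (arXiv v5 p. 12); lane: width-two bookkeeping] -/
def linA : ℝ := 2 * (hexCriticalFugacity * linE)

/-- The slope `B₂ := 2x_c·K₂·(x_c³y_2 + E₂(1 − x_c²))` of the linear upper bound. [cite: BeatonBousquetMelouDeGierDuminilCopinGuttmann2014, Corollary 8 (arXiv v5 p. 12); lane: width-two bookkeeping] -/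
def linB : ℝ := 2 * (hexCriticalFugacity * linK * (hexCriticalFugacity ^ 3 * yTwo + linE * (1 - hexCriticalFugacity ^ 2)))

/-- `0 ≤ A₂`. [cite: BeatonBousquetMelouDeGierDuminilCopinGuttmann2014, Corollary 8 (arXiv v5 p. 12); lane: width-two bookkeeping] -/
theorem linA_nonneg : 0 ≤ linA :=
  mul_nonneg (by norm_num) (mul_nonneg hexCriticalFugacity_pos_lt_one.1.le linE_nonneg)

/-- `0 ≤ B₂`. [cite: BeatonBousquetMelouDeGierDuminilCopinGuttmann2014, Corollary 8 (arXiv v5 p. 12); lane: width-two bookkeeping] -/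
theorem linB_nonneg : 0 ≤ linB := by
  have hx := hexCriticalFugacity_pos_lt_one
  have h1x2 : 0 ≤ 1 - hexCriticalFugacity ^ 2 := by nlinarith [hx.1, hx.2]
  unfold linB
  exact mul_nonneg (by norm_num) (mul_nonneg (mul_nonneg hx.1.le linK_nonneg)
    (add_nonneg (mul_nonneg (pow_nonneg hx.1.le 3) yTwo_pos.le) (mul_nonneg linE_nonneg h1x2)))

/-- `fsumY x_c y_2 N ≤ A₂ + B₂·N`. [cite: BeatonBousquetMelouDeGierDuminilCopinGuttmann2014, Corollary 8 (arXiv v5 p. 12); lane: width two] -/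
theorem fsumY_yTwo_le' (N : ℕ) : fsumY hexCriticalFugacity yTwo N ≤ linA + linB * N := fsumY_yTwo_le N

end W2

open W2

/-! ### §3. The bridge class of `S_{2,L}` at `y_2`: linear on both sides -/

/-- ★ **Linear UPPER bound at the threshold: `B_{2,L}(x_c; y_2) ≤ A₂ + B₂·(L + 2)`** for every `L` (completeness
`B_{2,L} ≤ fsumY(L+2)` and the Perron domination of the weave sums at `det(I − M(y_2)) = 0`).
[cite: BeatonBousquetMelouDeGierDuminilCopinGuttmann2014, Corollary 8 (arXiv v5 p. 12: "The series (in y) … B_T(x_c,y) … have radius of convergence y_T"; p. 12: "a rational function of x and y"); lane: the width-two series has a SIMPLE pole at y_2 — finite-L form, not in print] -/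
theorem stripGFy_two_stripYT_two_le (L : ℕ) :
    stripGFy 2 L (IsBetaDart 2) (stripYT 2) ≤ linA + linB * ((L : ℝ) + 2) := by
  rw [stripYT_two, ← yTwo_eq]
  have h := (stripGFy_le_fsumY yTwo_pos.le L).trans (fsumY_yTwo_le' (L + 2))
  push_cast at h
  exact h

/-- ★ **Linear LOWER bound at the threshold: `x_c⁴ y_2 · (L − 1) ≤ B_{2,L}(x_c; y_2)`** for every `L` (the tree's
`fsumY_yTwo_ge` at even lengths `2N`, moved to every `L` by the monotonicity of `B_{2,L}` in `L`).
[cite: BeatonBousquetMelouDeGierDuminilCopinGuttmann2014, Corollary 8 (arXiv v5 p. 12); lane: width two, finite-L form] -/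
theorem stripGFy_two_stripYT_two_ge (L : ℕ) :
    hexCriticalFugacity ^ 4 * yTwo * ((L : ℝ) - 1) ≤ stripGFy 2 L (IsBetaDart 2) (stripYT 2) := by
  rw [stripYT_two, ← yTwo_eq]
  have hx := hexCriticalFugacity_pos_lt_one
  have hc : 0 ≤ hexCriticalFugacity ^ 4 * yTwo := mul_nonneg (pow_nonneg hx.1.le 4) yTwo_pos.le
  -- `N := L / 2`, `2N ≤ L`, `L - 1 ≤ 2N`
  have h1 := fsumY_yTwo_ge (L / 2)
  have h2 := fsumY_le_stripGFy yTwo_pos.le (L / 2)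
  have h3 : stripGFy 2 (2 * (L / 2)) (IsBetaDart 2) yTwo ≤ stripGFy 2 L (IsBetaDart 2) yTwo :=
    stripGFy_beta_mono_L (Nat.mul_div_le L 2) yTwo_pos.le
  have h4 : ((L : ℝ) - 1) ≤ 2 * ((L / 2 : ℕ) : ℝ) := by
    have : L - 1 ≤ 2 * (L / 2) := by omega
    have h' : ((L : ℝ) - 1) ≤ ((L - 1 : ℕ) : ℝ) + 0 := by
      rcases Nat.eq_zero_or_pos L with rfl | hL
      · simp
      · rw [Nat.cast_sub hL]; simp
    calc ((L : ℝ) - 1) ≤ ((L - 1 : ℕ) : ℝ) := by linarith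
      _ ≤ ((2 * (L / 2) : ℕ) : ℝ) := by exact_mod_cast this
      _ = 2 * ((L / 2 : ℕ) : ℝ) := by push_cast; ring
  calc hexCriticalFugacity ^ 4 * yTwo * ((L : ℝ) - 1) ≤ hexCriticalFugacity ^ 4 * yTwo * (2 * ((L / 2 : ℕ) : ℝ)) :=
        mul_le_mul_of_nonneg_left h4 hc
    _ = 2 * (hexCriticalFugacity ^ 4 * yTwo) * ((L / 2 : ℕ) : ℝ) := by ring
    _ ≤ stripGFy 2 L (IsBetaDart 2) yTwo := h1.trans (h2.trans h3)

/-- **Two-sided, per unit length** (`L ≥ 1`): `x_c⁴y_2·(L−1)/L ≤ B_{2,L}(x_c; y_2)/L ≤ A₂ + 3B₂` — the width-two strip diverges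
EXACTLY LINEARLY at its own threshold (compare the width-one `B_{1,L}(x_c; y_1) = 2(L+1)` and the general `≥ c√L` rate).
[cite: BeatonBousquetMelouDeGierDuminilCopinGuttmann2014, Corollary 8 (arXiv v5 p. 12); lane: width two, finite-L form, not in print] -/
theorem stripGFy_two_stripYT_two_div_le {L : ℕ} (hL : 1 ≤ L) :
    stripGFy 2 L (IsBetaDart 2) (stripYT 2) / L ≤ linA + 3 * linB := by
  have hL' : (1 : ℝ) ≤ L := by exact_mod_cast hL
  have hL0 : (0 : ℝ) < L := by linarith
  rw [div_le_iff₀ hL0]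
  have h := stripGFy_two_stripYT_two_le L
  have hA := linA_nonneg
  have hB := linB_nonneg
  nlinarith

/-- Lower companion (`L ≥ 1`): `x_c⁴ y_2 (1 − 1/L) ≤ B_{2,L}(x_c; y_2)/L`. [cite: BeatonBousquetMelouDeGierDuminilCopinGuttmann2014, Corollary 8 (arXiv v5 p. 12); lane: width two] -/
theorem stripGFy_two_stripYT_two_div_ge {L : ℕ} (hL : 1 ≤ L) :
    hexCriticalFugacity ^ 4 * yTwo * (1 - 1 / (L : ℝ)) ≤ stripGFy 2 L (IsBetaDart 2) (stripYT 2) / L := by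
  have hL' : (1 : ℝ) ≤ L := by exact_mod_cast hL
  have hL0 : (0 : ℝ) < L := by linarith
  rw [le_div_iff₀ hL0]
  have h := stripGFy_two_stripYT_two_ge L
  have e : hexCriticalFugacity ^ 4 * yTwo * (1 - 1 / (L : ℝ)) * L = hexCriticalFugacity ^ 4 * yTwo * ((L : ℝ) - 1) := by
    field_simp
  rw [e]
  exact h

/-- **Eventually `B_{2,L}(x_c; y_2)/L ∈ [x_c⁴y_2/2, A₂ + 3B₂]`** (`L ≥ 2`): bounded away from `0` and `∞`.
[cite: BeatonBousquetMelouDeGierDuminilCopinGuttmann2014, Corollary 8 (arXiv v5 p. 12); lane: width two — the order of divergence at the threshold is exactly linear] -/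
theorem stripGFy_two_stripYT_two_div_mem_Icc {L : ℕ} (hL : 2 ≤ L) :
    stripGFy 2 L (IsBetaDart 2) (stripYT 2) / L ∈ Set.Icc (hexCriticalFugacity ^ 4 * yTwo / 2) (linA + 3 * linB) := by
  refine ⟨?_, stripGFy_two_stripYT_two_div_le (by omega)⟩
  have hx := hexCriticalFugacity_pos_lt_one
  have hc : 0 ≤ hexCriticalFugacity ^ 4 * yTwo := mul_nonneg (pow_nonneg hx.1.le 4) yTwo_pos.le
  have hL' : (2 : ℝ) ≤ L := by exact_mod_cast hL
  have hhalf : (1 : ℝ) / 2 ≤ 1 - 1 / (L : ℝ) := by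
    rw [sub_eq_add_neg, le_add_neg_iff_add_le]
    have : 1 / (L : ℝ) ≤ 1 / 2 := one_div_le_one_div_of_le (by norm_num) hL'
    linarith
  calc hexCriticalFugacity ^ 4 * yTwo / 2 = hexCriticalFugacity ^ 4 * yTwo * (1 / 2) := by ring
    _ ≤ hexCriticalFugacity ^ 4 * yTwo * (1 - 1 / (L : ℝ)) := mul_le_mul_of_nonneg_left hhalf hc
    _ ≤ _ := stripGFy_two_stripYT_two_div_ge (by omega)

end Literature.Probability.RandomPlanarGeometry.SAW.HV
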